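import Mathlib
import Summits.NavierStokesRegularity.FluidComputer.AbcClassIISections
import Summits.NavierStokesRegularity.FluidComputer.AbcClassIISectionCoords

/-!
# Class-II X0 chain, SECTIONS step with the COORDINATE EIGENVECTOR EXPORTED: the three certificate facts
# (T1)(T2)(T3) ⇒ a rapidly decaying class-II coordinate eigenvector with eigenvalue in `[x₁, x₂]`
# (instab3 g8, cell `ns-blowup`, 2026-08-27)

HONEST FRAMING (human ruling D-0035): nothing here is a claim about Navier–Stokes blow-up.
WHAT THIS IS NOT: not NS evidence. MODEL lane (forced-ABC linearisation, class II, coordinates of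
`AbcClassIIDefs`); no certificate, number or census word moves.

`coordinates_of_certificate` is instab4 g6's `AbcClassIISections.isLinNSEigenvalue_of_certificate`
(hypotheses (T1) head determinant signs, (T2) shell Schur forms, (T3) tail constants, VERBATIM) with the
conclusion `∃ λ ∈ [x₁, x₂], ∃ wc : Idx → ℂ, wc ≠ 0, rapidly decaying, coordinate eigen-equation` instead of
`Torus.IsLinNSEigenvalue` — the proof is instab4's (reindexing `head ⊕ (shell ⊕ deep)`, instab3's
`SkewCutSchurCoercivity.exists_eigenvalue_of_certificate` per level, normalisation), ending in
`AbcClassIISectionCoords.coordinates_of_section_eigenpairs'`. Purpose: the input of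
`AbcInertiaDictionary.eq_of_coordinate_leader` (INERTIA-3L «exactly one»).

Mathlib + `AbcClassIISections` + `AbcClassIISectionCoords`; no new definitions; std axioms. [folklore]
-/

noncomputable section

open scoped BigOperators ComplexConjugate InnerProductSpace Matrix
open Finset MeasureTheory UnitAddTorus Matrix

namespace Summit.NavierStokesRegularity.FluidComputer.AbcClassII

open Literature.Analysis.FunctionSpaces Literature.Analysis.FunctionSpaces.Torus
open Literature.Analysis.FunctionSpaces.EuclideanSpace
open Literature.Analysis.FluidPDE Literature.Analysis.FluidPDE.SteadyLattice
open Literature.Analysis.FluidPDE.ScalarFourier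

section SectionsCoords

/-- **(T1)(T2)(T3) ⇒ a rapidly decaying class-II coordinate eigenvector with eigenvalue in `[x₁, x₂]`**
(instab4's `isLinNSEigenvalue_of_certificate` with the coordinates exported). -/
theorem coordinates_of_certificate {R : ℝ} (hR : 1 ≤ R) (K : ℕ) {x₁ x₂ : ℝ} (hlt : x₁ < x₂)
    (μ₁ μ₂ : ℝ) (hμ₁ : 0 < μ₁) (hμ₂ : 0 < μ₂)
    (hq₁ : μ₁ ≤ x₁ + ((K : ℝ) + 2) ^ 2 / R - Real.sqrt 2) (hq₂ : μ₂ ≤ x₂ + ((K : ℝ) + 2) ^ 2 / R - Real.sqrt 2)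
    (hdet : (Matrix.of fun a b : ↥(cubeIdx K) =>
        (if (a : Idx) = b then x₁ + onormSq (b : Idx).1 / R else 0) - amat a b).det *
      (Matrix.of fun a b : ↥(cubeIdx K) =>
        (if (a : Idx) = b then x₂ + onormSq (b : Idx).1 / R else 0) - amat a b).det < 0)
    (hX₁ : ∀ w : ↥(cubeIdx (K + 1) \ cubeIdx K) → ℝ, μ₁ * (w ⬝ᵥ w) ≤
      ∑ a : ↥(cubeIdx (K + 1) \ cubeIdx K), (x₁ + onormSq (a : Idx).1 / R) * w a ^ 2 - Real.sqrt 2 * (w ⬝ᵥ w) -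
        w ⬝ᵥ (((Matrix.of fun (a : ↥(cubeIdx (K + 1) \ cubeIdx K)) (b : ↥(cubeIdx K)) =>
            (if (a : Idx) = b then x₁ + onormSq (b : Idx).1 / R else 0) - amat a b) *
          (Matrix.of fun a b : ↥(cubeIdx K) =>
            (if (a : Idx) = b then x₁ + onormSq (b : Idx).1 / R else 0) - amat a b)⁻¹ *
          (Matrix.of fun (a : ↥(cubeIdx K)) (b : ↥(cubeIdx (K + 1) \ cubeIdx K)) =>
            (if (a : Idx) = b then x₁ + onormSq (b : Idx).1 / R else 0) - amat a b)) *ᵥ w))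
    (hX₂ : ∀ w : ↥(cubeIdx (K + 1) \ cubeIdx K) → ℝ, μ₂ * (w ⬝ᵥ w) ≤
      ∑ a : ↥(cubeIdx (K + 1) \ cubeIdx K), (x₂ + onormSq (a : Idx).1 / R) * w a ^ 2 - Real.sqrt 2 * (w ⬝ᵥ w) -
        w ⬝ᵥ (((Matrix.of fun (a : ↥(cubeIdx (K + 1) \ cubeIdx K)) (b : ↥(cubeIdx K)) =>
            (if (a : Idx) = b then x₂ + onormSq (b : Idx).1 / R else 0) - amat a b) *
          (Matrix.of fun a b : ↥(cubeIdx K) =>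
            (if (a : Idx) = b then x₂ + onormSq (b : Idx).1 / R else 0) - amat a b)⁻¹ *
          (Matrix.of fun (a : ↥(cubeIdx K)) (b : ↥(cubeIdx (K + 1) \ cubeIdx K)) =>
            (if (a : Idx) = b then x₂ + onormSq (b : Idx).1 / R else 0) - amat a b)) *ᵥ w)) :
    ∃ lam ∈ Set.Icc x₁ x₂, ∃ wc : Idx → ℂ, wc ≠ 0 ∧
      (∀ s : ℕ, Summable fun i : Idx => (1 + onormSq i.1) ^ s * ‖wc i‖ ^ 2) ∧
      ∀ i : Idx, ((-(onormSq i.1 / R) : ℝ) : ℂ) * wc i + ∑ j ∈ nbrIdx i, ((amat i j : ℝ) : ℂ) * wc j =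
        (lam : ℂ) * wc i := by
  classical
  have hR0 : 0 < R := by linarith
  -- abbreviations: the section entry and the head / shell blocks at `x`
  set S : ℝ → Idx → Idx → ℝ := fun x i j => (if i = j then x + onormSq j.1 / R else 0) - amat i j with hS
  -- the section eigenpair at level `K + 1 + n`
  have key : ∀ n : ℕ, ∃ x ∈ Set.Icc x₁ x₂, ∃ v : Idx → ℝ,
      (∀ i ∈ cubeIdx (K + 1 + n), -(onormSq i.1 / R) * v i + ∑ j ∈ cubeIdx (K + 1 + n), amat i j * v j = x * v i) ∧
      ∑ j ∈ cubeIdx (K + 1 + n), v j ^ 2 = 1 := by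
    intro n
    -- index pieces (subtypes of `Idx`)
    have h1 : cubeIdx K ⊆ cubeIdx (K + 1) := cubeIdx_mono (Nat.le_succ K)
    have h2 : cubeIdx (K + 1) ⊆ cubeIdx (K + 1 + n) := cubeIdx_mono (Nat.le_add_right _ _)
    -- shell / deep membership facts
    have hSh_osup : ∀ s : ↥(cubeIdx (K + 1) \ cubeIdx K), osupNorm (s : Idx).1 = K + 1 := by
      intro s
      have hs := Finset.mem_sdiff.mp s.2
      have ha := mem_cubeIdx.mp hs.1
      have hb : ¬ osupNorm (s : Idx).1 ≤ K := fun h => hs.2 (mem_cubeIdx.mpr h)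
      omega
    have hDp_osup : ∀ d : ↥(cubeIdx (K + 1 + n) \ cubeIdx (K + 1)), K + 2 ≤ osupNorm (d : Idx).1 := by
      intro d
      have hd := Finset.mem_sdiff.mp d.2
      have hb : ¬ osupNorm (d : Idx).1 ≤ K + 1 := fun h => hd.2 (mem_cubeIdx.mpr h)
      omega
    have hH_osup : ∀ h : ↥(cubeIdx K), osupNorm (h : Idx).1 ≤ K := fun h => mem_cubeIdx.mp h.2
    -- the embedding of the tail type into `Idx`
    set ρ' : (↥(cubeIdx (K + 1) \ cubeIdx K) ⊕ ↥(cubeIdx (K + 1 + n) \ cubeIdx (K + 1))) → Idx :=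
      fun a => Sum.elim (fun s : ↥(cubeIdx (K + 1) \ cubeIdx K) => (s : Idx))
        (fun d : ↥(cubeIdx (K + 1 + n) \ cubeIdx (K + 1)) => (d : Idx)) a with hρ'
    set ρ : (↥(cubeIdx K) ⊕ (↥(cubeIdx (K + 1) \ cubeIdx K) ⊕ ↥(cubeIdx (K + 1 + n) \ cubeIdx (K + 1)))) → Idx :=
      fun a => Sum.elim (fun h : ↥(cubeIdx K) => (h : Idx)) ρ' a with hρ
    -- the Galerkin matrix on the sum type and its blocks
    set L : Matrix (↥(cubeIdx K) ⊕ (↥(cubeIdx (K + 1) \ cubeIdx K) ⊕ ↥(cubeIdx (K + 1 + n) \ cubeIdx (K + 1))))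
        (↥(cubeIdx K) ⊕ (↥(cubeIdx (K + 1) \ cubeIdx K) ⊕ ↥(cubeIdx (K + 1 + n) \ cubeIdx (K + 1)))) ℝ :=
      Matrix.of fun a b => (if a = b then -(onormSq (ρ b).1 / R) else 0) + amat (ρ a) (ρ b) with hL
    set A : ℝ → Matrix ↥(cubeIdx K) ↥(cubeIdx K) ℝ := fun x => Matrix.of fun a b => S x a b with hA
    set B : ℝ → Matrix ↥(cubeIdx K) ↥(cubeIdx (K + 1) \ cubeIdx K) ℝ := fun x => Matrix.of fun a b => S x a b with hB
    set C : ℝ → Matrix ↥(cubeIdx (K + 1) \ cubeIdx K) ↥(cubeIdx K) ℝ := fun x => Matrix.of fun a b => S x a b with hC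
    set D : ℝ → Matrix (↥(cubeIdx (K + 1) \ cubeIdx K) ⊕ ↥(cubeIdx (K + 1 + n) \ cubeIdx (K + 1)))
        (↥(cubeIdx (K + 1) \ cubeIdx K) ⊕ ↥(cubeIdx (K + 1 + n) \ cubeIdx (K + 1))) ℝ :=
      fun x => Matrix.of fun a b => S x (ρ' a) (ρ' b) with hD
    set lam : ℝ → (↥(cubeIdx (K + 1) \ cubeIdx K) ⊕ ↥(cubeIdx (K + 1 + n) \ cubeIdx (K + 1))) → ℝ :=
      fun x a => x + onormSq (ρ' a).1 / R with hlam
    -- ρ respects equality (injective on the relevant cases) : different summands have different images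
    have hHS : ∀ (h : ↥(cubeIdx K)) (s : ↥(cubeIdx (K + 1) \ cubeIdx K)), (h : Idx) ≠ s := by
      intro h s e; have := hSh_osup s; have := hH_osup h; rw [e] at *; omega
    have hHD : ∀ (h : ↥(cubeIdx K)) (d : ↥(cubeIdx (K + 1 + n) \ cubeIdx (K + 1))), (h : Idx) ≠ d := by
      intro h d e; have := hDp_osup d; have := hH_osup h; rw [e] at *; omega
    have hSD : ∀ (s : ↥(cubeIdx (K + 1) \ cubeIdx K)) (d : ↥(cubeIdx (K + 1 + n) \ cubeIdx (K + 1))), (s : Idx) ≠ d := by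
      intro s d e; have := hDp_osup d; have := hSh_osup s; rw [e] at *; omega
    have hHD0 : ∀ (h : ↥(cubeIdx K)) (d : ↥(cubeIdx (K + 1 + n) \ cubeIdx (K + 1))),
        amat h d = 0 ∧ amat d h = 0 := by
      intro h d
      have := hDp_osup d; have := hH_osup h
      exact ⟨amat_eq_zero_of_shells (Or.inl (by omega)), amat_eq_zero_of_shells (Or.inr (by omega))⟩
    -- ρ is injective
    have hρ_inl : ∀ h : ↥(cubeIdx K), ρ (Sum.inl h) = h := fun h => rfl
    have hρ_s : ∀ s : ↥(cubeIdx (K + 1) \ cubeIdx K), ρ (Sum.inr (Sum.inl s)) = s := fun s => rfl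
    have hρ_d : ∀ d : ↥(cubeIdx (K + 1 + n) \ cubeIdx (K + 1)), ρ (Sum.inr (Sum.inr d)) = d := fun d => rfl
    have hρ'_s : ∀ s : ↥(cubeIdx (K + 1) \ cubeIdx K), ρ' (Sum.inl s) = s := fun s => rfl
    have hρ'_d : ∀ d : ↥(cubeIdx (K + 1 + n) \ cubeIdx (K + 1)), ρ' (Sum.inr d) = d := fun d => rfl
    have hρinj : Function.Injective ρ := by
      intro a b hab
      rcases a with h | s | d <;> rcases b with h' | s' | d'
      · rw [hρ_inl, hρ_inl] at hab; exact congrArg _ (Subtype.ext hab)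
      · rw [hρ_inl, hρ_s] at hab; exact absurd hab (hHS h s')
      · rw [hρ_inl, hρ_d] at hab; exact absurd hab (hHD h d')
      · rw [hρ_s, hρ_inl] at hab; exact absurd hab.symm (hHS h' s)
      · rw [hρ_s, hρ_s] at hab; exact congrArg _ (congrArg _ (Subtype.ext hab))
      · rw [hρ_s, hρ_d] at hab; exact absurd hab (hSD s d')
      · rw [hρ_d, hρ_inl] at hab; exact absurd hab.symm (hHD h' d)
      · rw [hρ_d, hρ_s] at hab; exact absurd hab.symm (hSD s' d)
      · rw [hρ_d, hρ_d] at hab; exact congrArg _ (congrArg _ (Subtype.ext hab))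
    have hρ'inj : Function.Injective ρ' := by
      intro a b hab
      have := @hρinj (Sum.inr a) (Sum.inr b) hab
      exact Sum.inr_injective this
    -- every entry of `x • 1 − L` is the section entry
    have hLS : ∀ (x : ℝ) (a b : (↥(cubeIdx K) ⊕ (↥(cubeIdx (K + 1) \ cubeIdx K) ⊕ ↥(cubeIdx (K + 1 + n) \ cubeIdx (K + 1))))),
        (x • (1 : Matrix (↥(cubeIdx K) ⊕ (↥(cubeIdx (K + 1) \ cubeIdx K) ⊕ ↥(cubeIdx (K + 1 + n) \ cubeIdx (K + 1)))) (↥(cubeIdx K) ⊕ (↥(cubeIdx (K + 1) \ cubeIdx K) ⊕ ↥(cubeIdx (K + 1 + n) \ cubeIdx (K + 1)))) ℝ) - L) a b = S x (ρ a) (ρ b) := by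
      intro x a b
      rw [Matrix.sub_apply, Matrix.smul_apply, Matrix.one_apply, hL, Matrix.of_apply]
      simp only [hS]
      by_cases hab : a = b
      · subst hab
        simp only [if_true, smul_eq_mul, mul_one]
        ring
      · have hab' : ρ a ≠ ρ b := fun e => hab (hρinj e)
        simp only [if_neg hab, if_neg hab', smul_eq_mul, mul_zero]
        ring
    -- the block identity
    have hre : ∀ M : Matrix (↥(cubeIdx K) ⊕ (↥(cubeIdx (K + 1) \ cubeIdx K) ⊕ ↥(cubeIdx (K + 1 + n) \ cubeIdx (K + 1))))
        (↥(cubeIdx K) ⊕ (↥(cubeIdx (K + 1) \ cubeIdx K) ⊕ ↥(cubeIdx (K + 1 + n) \ cubeIdx (K + 1)))) ℝ,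
        Matrix.reindex (Equiv.refl _) (Equiv.refl _) M = M := fun M => by ext; simp
    have hblock : ∀ x : ℝ, Matrix.reindex (Equiv.refl _) (Equiv.refl _) (x • (1 : Matrix (↥(cubeIdx K) ⊕ (↥(cubeIdx (K + 1) \ cubeIdx K) ⊕ ↥(cubeIdx (K + 1 + n) \ cubeIdx (K + 1)))) (↥(cubeIdx K) ⊕ (↥(cubeIdx (K + 1) \ cubeIdx K) ⊕ ↥(cubeIdx (K + 1 + n) \ cubeIdx (K + 1)))) ℝ) - L) =
        Matrix.fromBlocks (A x) (Matrix.fromCols (B x) 0) (Matrix.fromRows (C x) 0) (D x) := by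
      intro x
      rw [hre]
      ext a b
      rw [hLS]
      rcases a with h | s | d <;> rcases b with h' | s' | d'
      · rw [Matrix.fromBlocks_apply₁₁, hρ_inl, hρ_inl]; rfl
      · rw [Matrix.fromBlocks_apply₁₂, Matrix.fromCols_apply_inl, hρ_inl, hρ_s]; rfl
      · rw [Matrix.fromBlocks_apply₁₂, Matrix.fromCols_apply_inr, Matrix.zero_apply, hρ_inl, hρ_d]
        simp only [hS, if_neg (hHD h d'), (hHD0 h d').1, sub_zero]
      · rw [Matrix.fromBlocks_apply₂₁, Matrix.fromRows_apply_inl, hρ_s, hρ_inl]; rfl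
      · rw [Matrix.fromBlocks_apply₂₂, hρ_s, hρ_s]; rfl
      · rw [Matrix.fromBlocks_apply₂₂, hρ_s, hρ_d]; rfl
      · rw [Matrix.fromBlocks_apply₂₁, Matrix.fromRows_apply_inr, Matrix.zero_apply, hρ_d, hρ_inl]
        have hne : ((d : Idx)) ≠ (h' : Idx) := fun e => hHD h' d e.symm
        simp only [hS, if_neg hne, (hHD0 h' d).2, sub_zero]
      · rw [Matrix.fromBlocks_apply₂₂, hρ_d, hρ_s]; rfl
      · rw [Matrix.fromBlocks_apply₂₂, hρ_d, hρ_d]; rfl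
    -- the tail inequality from `section_form_ge`, by zero-padding
    have htail : ∀ (x : ℝ) (w : (↥(cubeIdx (K + 1) \ cubeIdx K) ⊕ ↥(cubeIdx (K + 1 + n) \ cubeIdx (K + 1))) → ℝ),
        ∑ a, lam x a * w a ^ 2 - Real.sqrt 2 * (w ⬝ᵥ w) ≤ w ⬝ᵥ (D x *ᵥ w) := by
      intro x w
      -- the zero-padded vector on `Idx`
      set u : Idx → ℝ := fun j => if hs : j ∈ cubeIdx (K + 1) \ cubeIdx K then w (Sum.inl ⟨j, hs⟩)
        else if hd : j ∈ cubeIdx (K + 1 + n) \ cubeIdx (K + 1) then w (Sum.inr ⟨j, hd⟩) else 0 with hu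
      have huH : ∀ j ∈ cubeIdx K, u j = 0 := by
        intro j hj
        have h1' : j ∉ cubeIdx (K + 1) \ cubeIdx K := fun h => (Finset.mem_sdiff.mp h).2 hj
        have h2' : j ∉ cubeIdx (K + 1 + n) \ cubeIdx (K + 1) := fun h => (Finset.mem_sdiff.mp h).2 (h1 hj)
        simp only [hu, dif_neg h1', dif_neg h2']
      have huS : ∀ s : ↥(cubeIdx (K + 1) \ cubeIdx K), u s = w (Sum.inl s) := by
        intro s; simp only [hu, dif_pos s.2]
      have huD : ∀ d : ↥(cubeIdx (K + 1 + n) \ cubeIdx (K + 1)), u d = w (Sum.inr d) := by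
        intro d
        have h1' : (d : Idx) ∉ cubeIdx (K + 1) \ cubeIdx K :=
          fun h => (Finset.mem_sdiff.mp d.2).2 (Finset.mem_sdiff.mp h).1
        simp only [hu, dif_neg h1', dif_pos d.2]
      -- translate the three sums
      have e1 : ∑ i ∈ cubeIdx (K + 1 + n), (x + onormSq i.1 / R) * u i ^ 2 = ∑ a, lam x a * w a ^ 2 := by
        rw [sum_cubeIdx_split K n (fun i => (x + onormSq i.1 / R) * u i ^ 2),
          Finset.sum_eq_zero (fun i hi => by rw [huH i hi]; ring), zero_add, Fintype.sum_sum_type,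
          ← Finset.sum_coe_sort (cubeIdx (K + 1) \ cubeIdx K), ← Finset.sum_coe_sort (cubeIdx (K + 1 + n) \ cubeIdx (K + 1))]
        exact congrArg₂ (· + ·) (Finset.sum_congr rfl fun s _ => by rw [huS]; rfl)
          (Finset.sum_congr rfl fun d _ => by rw [huD]; rfl)
      have e2 : ∑ i ∈ cubeIdx (K + 1 + n), u i ^ 2 = w ⬝ᵥ w := by
        rw [sum_cubeIdx_split K n (fun i => u i ^ 2), Finset.sum_eq_zero (fun i hi => by rw [huH i hi]; ring),
          zero_add, dotProduct, Fintype.sum_sum_type,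
          ← Finset.sum_coe_sort (cubeIdx (K + 1) \ cubeIdx K), ← Finset.sum_coe_sort (cubeIdx (K + 1 + n) \ cubeIdx (K + 1))]
        exact congrArg₂ (· + ·) (Finset.sum_congr rfl fun s _ => by rw [huS, sq])
          (Finset.sum_congr rfl fun d _ => by rw [huD, sq])
      have e3inner : ∀ i : Idx, ∑ j ∈ cubeIdx (K + 1 + n), S x i j * u j = ∑ b, S x i (ρ' b) * w b := by
        intro i
        rw [sum_cubeIdx_split K n (fun j => S x i j * u j), Finset.sum_eq_zero (fun j hj => by rw [huH j hj]; ring),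
          zero_add, Fintype.sum_sum_type,
          ← Finset.sum_coe_sort (cubeIdx (K + 1) \ cubeIdx K), ← Finset.sum_coe_sort (cubeIdx (K + 1 + n) \ cubeIdx (K + 1))]
        exact congrArg₂ (· + ·) (Finset.sum_congr rfl fun s _ => by rw [huS]; rfl)
          (Finset.sum_congr rfl fun d _ => by rw [huD]; rfl)
      have e3 : ∑ i ∈ cubeIdx (K + 1 + n), u i * ∑ j ∈ cubeIdx (K + 1 + n), S x i j * u j = w ⬝ᵥ (D x *ᵥ w) := by
        rw [sum_cubeIdx_split K n (fun i => u i * ∑ j ∈ cubeIdx (K + 1 + n), S x i j * u j),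
          Finset.sum_eq_zero (fun i hi => by rw [huH i hi]; ring), zero_add, dotProduct, Fintype.sum_sum_type,
          ← Finset.sum_coe_sort (cubeIdx (K + 1) \ cubeIdx K), ← Finset.sum_coe_sort (cubeIdx (K + 1 + n) \ cubeIdx (K + 1))]
        refine congrArg₂ (· + ·) (Finset.sum_congr rfl fun s _ => ?_) (Finset.sum_congr rfl fun d _ => ?_)
        · rw [huS, e3inner, Matrix.mulVec, dotProduct]; rfl
        · rw [huD, e3inner, Matrix.mulVec, dotProduct]; rfl
      have h := section_form_ge R x (K + 1 + n) u
      rw [e1, e2, e3] at h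
      exact h
    -- the deep tail constants
    have hdeep : ∀ (x μ : ℝ), μ ≤ x + ((K : ℝ) + 2) ^ 2 / R - Real.sqrt 2 →
        ∀ d : ↥(cubeIdx (K + 1 + n) \ cubeIdx (K + 1)), μ ≤ lam x (Sum.inr d) - Real.sqrt 2 := by
      intro x μ hμ d
      have h1' : ((K : ℝ) + 2) ^ 2 ≤ onormSq (d : Idx).1 := by
        have h0 := sq_osupNorm_le_onormSq (d : Idx).1
        have hK : ((K : ℝ) + 2) ≤ ((osupNorm (d : Idx).1 : ℕ) : ℝ) := by
          have h := (Nat.cast_le (α := ℝ)).mpr (hDp_osup d)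
          rw [Nat.cast_add, Nat.cast_ofNat] at h
          exact h
        have hK0 : 0 ≤ (K : ℝ) + 2 := by positivity
        exact (pow_le_pow_left₀ hK0 hK 2).trans h0
      have h2' : ((K : ℝ) + 2) ^ 2 / R ≤ onormSq (d : Idx).1 / R := div_le_div_of_nonneg_right h1' hR0.le
      show μ ≤ x + onormSq (d : Idx).1 / R - Real.sqrt 2
      linarith only [hμ, h2']
    -- invertibility of the heads
    have hsign : (A x₁).det * (A x₂).det < 0 := hdet
    have hd1 : (A x₁).det ≠ 0 := fun h => by rw [h, zero_mul] at hsign; exact lt_irrefl _ hsign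
    have hd2 : (A x₂).det ≠ 0 := fun h => by rw [h, mul_zero] at hsign; exact lt_irrefl _ hsign
    letI : Invertible (A x₁) := (A x₁).invertibleOfIsUnitDet (isUnit_iff_ne_zero.mpr hd1)
    letI : Invertible (A x₂) := (A x₂).invertibleOfIsUnitDet (isUnit_iff_ne_zero.mpr hd2)
    have hX₁' : ∀ w : ↥(cubeIdx (K + 1) \ cubeIdx K) → ℝ, μ₁ * (w ⬝ᵥ w) ≤
        ∑ i, lam x₁ (Sum.inl i) * w i ^ 2 - Real.sqrt 2 * (w ⬝ᵥ w) - w ⬝ᵥ ((C x₁ * ⅟(A x₁) * B x₁) *ᵥ w) := by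
      intro w; rw [Matrix.invOf_eq_nonsing_inv]; exact hX₁ w
    have hX₂' : ∀ w : ↥(cubeIdx (K + 1) \ cubeIdx K) → ℝ, μ₂ * (w ⬝ᵥ w) ≤
        ∑ i, lam x₂ (Sum.inl i) * w i ^ 2 - Real.sqrt 2 * (w ⬝ᵥ w) - w ⬝ᵥ ((C x₂ * ⅟(A x₂) * B x₂) *ᵥ w) := by
      intro w; rw [Matrix.invOf_eq_nonsing_inv]; exact hX₂ w
    obtain ⟨x, hx, v, hv0, hLv⟩ := SkewCutSchurCoercivity.exists_eigenvalue_of_certificate L (Equiv.refl _)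
      hlt (A x₁) (A x₂) (B x₁) (B x₂) (C x₁) (C x₂) (D x₁) (D x₂) (lam x₁) (lam x₂) (Real.sqrt 2) μ₁ μ₂ hμ₁ hμ₂
      (hblock x₁) (hblock x₂) (htail x₁) (htail x₂) hX₁' hX₂' (hdeep x₁ μ₁ hq₁) (hdeep x₂ μ₂ hq₂) hsign
    -- back to `Idx`: zero-padding of `v`, normalised
    set V : Idx → ℝ := fun j => if hh : j ∈ cubeIdx K then v (Sum.inl ⟨j, hh⟩)
      else if hs : j ∈ cubeIdx (K + 1) \ cubeIdx K then v (Sum.inr (Sum.inl ⟨j, hs⟩))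
      else if hd : j ∈ cubeIdx (K + 1 + n) \ cubeIdx (K + 1) then v (Sum.inr (Sum.inr ⟨j, hd⟩)) else 0 with hV
    have hVρ : ∀ a, V (ρ a) = v a := by
      intro a
      rcases a with h | s | d
      · simp only [hV, hρ, Sum.elim_inl, dif_pos h.2]
      · have h1' : (s : Idx) ∉ cubeIdx K := (Finset.mem_sdiff.mp s.2).2
        simp only [hV, hρ, hρ', Sum.elim_inr, Sum.elim_inl, dif_neg h1', dif_pos s.2]
      · have h2' : (d : Idx) ∉ cubeIdx (K + 1) := (Finset.mem_sdiff.mp d.2).2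
        have h1' : (d : Idx) ∉ cubeIdx K := fun h => h2' (h1 h)
        have h3' : (d : Idx) ∉ cubeIdx (K + 1) \ cubeIdx K := fun h => h2' (Finset.mem_sdiff.mp h).1
        simp only [hV, hρ, hρ', Sum.elim_inr, dif_neg h1', dif_neg h3', dif_pos d.2]
    -- sums over `cubeIdx (K+1+n)` of functions of `V` are sums over the sum type
    have hsum : ∀ g : Idx → ℝ → ℝ, ∑ j ∈ cubeIdx (K + 1 + n), g j (V j) = ∑ a, g (ρ a) (v a) := by
      intro g
      rw [sum_cubeIdx_split, Fintype.sum_sum_type, Fintype.sum_sum_type, ← Finset.sum_coe_sort (cubeIdx K),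
        ← Finset.sum_coe_sort (cubeIdx (K + 1) \ cubeIdx K), ← Finset.sum_coe_sort (cubeIdx (K + 1 + n) \ cubeIdx (K + 1))]
      refine congrArg₂ (· + ·) (Finset.sum_congr rfl fun h _ => by rw [← hVρ (Sum.inl h)]; rfl)
        (congrArg₂ (· + ·) (Finset.sum_congr rfl fun s _ => by rw [← hVρ (Sum.inr (Sum.inl s))]; rfl)
          (Finset.sum_congr rfl fun d _ => by rw [← hVρ (Sum.inr (Sum.inr d))]; rfl))
    have hnormV : ∑ j ∈ cubeIdx (K + 1 + n), V j ^ 2 = ∑ a, v a ^ 2 := hsum (fun _ r => r ^ 2)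
    have hpos : 0 < ∑ a, v a ^ 2 := by
      obtain ⟨a, ha⟩ : ∃ a, v a ≠ 0 := by
        by_contra h
        push Not at h
        exact hv0 (funext fun a => h a)
      have ha2 : 0 < v a ^ 2 := lt_of_le_of_ne (sq_nonneg _) (Ne.symm (pow_ne_zero 2 ha))
      exact lt_of_lt_of_le ha2 (Finset.single_le_sum (f := fun a => v a ^ 2)
        (fun _ _ => sq_nonneg _) (Finset.mem_univ a))
    set N : ℝ := Real.sqrt (∑ a, v a ^ 2) with hN
    have hNpos : 0 < N := Real.sqrt_pos.mpr hpos
    refine ⟨x, Set.Ioo_subset_Icc_self hx, fun j => V j / N, ?_, ?_⟩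
    · intro i hi
      -- the eigen-equation at `i = ρ a`
      obtain ⟨a, rfl⟩ : ∃ a, ρ a = i := by
        by_cases hh : i ∈ cubeIdx K
        · exact ⟨Sum.inl ⟨i, hh⟩, rfl⟩
        by_cases hs : i ∈ cubeIdx (K + 1) \ cubeIdx K
        · exact ⟨Sum.inr (Sum.inl ⟨i, hs⟩), rfl⟩
        have hd : i ∈ cubeIdx (K + 1 + n) \ cubeIdx (K + 1) := by
          rw [Finset.mem_sdiff]
          refine ⟨hi, fun h => hs (Finset.mem_sdiff.mpr ⟨h, hh⟩)⟩
        exact ⟨Sum.inr (Sum.inr ⟨i, hd⟩), rfl⟩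
      have hrow := congrFun hLv a
      simp only [Matrix.mulVec, dotProduct, Pi.smul_apply, smul_eq_mul, hL, Matrix.of_apply] at hrow
      -- Σ_b ((if a = b then −κ else 0) + amat) v b = x v a
      have e : ∑ b, ((if a = b then -(onormSq (ρ b).1 / R) else 0) + amat (ρ a) (ρ b)) * v b =
          -(onormSq (ρ a).1 / R) * v a + ∑ b, amat (ρ a) (ρ b) * v b := by
        simp only [add_mul, Finset.sum_add_distrib, ite_mul, zero_mul, Finset.sum_ite_eq, Finset.mem_univ, if_true]
      rw [e] at hrow
      have hs' := hsum (fun j r => amat (ρ a) j * r)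
      show -(onormSq (ρ a).1 / R) * (V (ρ a) / N) + ∑ j ∈ cubeIdx (K + 1 + n), amat (ρ a) j * (V j / N) =
        x * (V (ρ a) / N)
      rw [hVρ]
      have hsN : ∑ j ∈ cubeIdx (K + 1 + n), amat (ρ a) j * (V j / N) = (∑ b, amat (ρ a) (ρ b) * v b) / N := by
        rw [← hs', Finset.sum_div]
        exact Finset.sum_congr rfl fun j _ => by ring
      rw [hsN]
      have hS' : ∑ b, amat (ρ a) (ρ b) * v b = x * v a + onormSq (ρ a).1 / R * v a := by
        linarith only [hrow]
      rw [hS']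
      ring
    · have : ∑ j ∈ cubeIdx (K + 1 + n), (V j / N) ^ 2 = (∑ j ∈ cubeIdx (K + 1 + n), V j ^ 2) / N ^ 2 := by
        rw [Finset.sum_div]; exact Finset.sum_congr rfl fun j _ => by rw [div_pow]
      rw [this, hnormV, hN, Real.sq_sqrt hpos.le, div_self hpos.ne']
  -- assemble
  choose xs hxs v hv using key
  exact coordinates_of_section_eigenpairs' hR (K + 1) v xs hxs (fun n => (hv n).1) (fun n => (hv n).2)


end SectionsCoords

end Summit.NavierStokesRegularity.FluidComputer.AbcClassII

end
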